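import Summits.CriticalPhenomena.SAWScalingLimit.Theses.SAWRenewalTightness
import Literature.Probability.RandomPlanarGeometry.ChordalReversibility
import Literature.Probability.Percolation.LoopRotationInvarianceAssembly

/-!
# Exact lattice reversibility of the critical `ℤ²` SAW law (`SAW.law`), and swapped endpoint approximations

Support file of the standing disprover of crux `SubseqIdentification` (stmt-CriticalPhenomena-0783;
cdisprove cycle 2), consumed by `Reversal.lean` (the reversibility debt of the crux).

§1: time reversal `γ ↦ ⟨γ.walk.reverse, γ.isPath.reverse⟩` of the self-avoiding walks of
`Ω_δ ⊆ δℤ²` (written inline — an involution `SAW(a → b) → SAW(b → a)` preserving the critical weight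
`x_c^{|γ|}`) pushes `SAW.weight Ω δ a b` to `SAW.weight Ω δ b a` and `SAW.law Ω δ a b` to
`SAW.law Ω δ b a` at EVERY mesh, junk cases included (`map_reverse_weight`, `map_reverse_law`;
Lawler–Schramm–Werner 2004 §3.1: the weight `β^{-n}` is invariant under `ω ↦ ω^R`), and reverses the
curve class (`curve_reverse_saw`); hence `∫ f(γ.curve) dP^{(b,a)}_δ = ∫ f(reverse γ.curve) dP^{(a,b)}_δ`.
§2: an endpoint approximation of `(D; a, b)` read backwards is one of `D.swap = (D; b, a)`.
-/

noncomputable section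

open Literature.Probability.RandomPlanarGeometry Literature.Probability.RandomPlanarGeometry.SAW
  Literature.Probability.LatticeModels Literature.Probability.Percolation Literature.Probability
  MeasureTheory Filter Topology Set
open scoped NNReal ENNReal BoundedContinuousFunction

namespace Summit.CriticalPhenomena.SAWScalingLimit.Theorems.SubseqIdentification.Negative

/-! ## §1 Time reversal of the self-avoiding walks of `Ω_δ ⊆ δℤ²` -/

section Lattice

variable {Ω : Set ℂ} {δ : ℝ} {a b : Site 2}

/-! Time reversal `γ ↦ ⟨γ.walk.reverse, γ.isPath.reverse⟩ : SAW(a → b) → SAW(b → a)` is written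
inline throughout (no new definitions in a Theorems file); it is an involution preserving `|γ|`. -/

/-- Time reversal is an involution. [folklore] -/
theorem reverse_reverse_saw (γ : DomainSAW Ω δ a b) :
    (⟨(⟨γ.walk.reverse, γ.isPath.reverse⟩ : DomainSAW Ω δ b a).walk.reverse,
      (⟨γ.walk.reverse, γ.isPath.reverse⟩ : DomainSAW Ω δ b a).isPath.reverse⟩ : DomainSAW Ω δ a b) = γ := by
  obtain ⟨w, hw⟩ := γ
  simp only [SimpleGraph.Walk.reverse_reverse]

/-- Reversal preserves the number of steps `|γ|`. [folklore] -/
theorem length_reverse_saw (γ : DomainSAW Ω δ a b) :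
    (⟨γ.walk.reverse, γ.isPath.reverse⟩ : DomainSAW Ω δ b a).length = γ.length := by
  simp [DomainSAW.length]

/-- **Reversing the walk reverses its curve class** (the polyline through the reversed vertex list
is the time reversal of the polyline modulo increasing reparametrisation,
`reparamDist_polyline_reverse`). [folklore] -/
theorem curve_reverse_saw (γ : DomainSAW Ω δ a b) :
    (⟨γ.walk.reverse, γ.isPath.reverse⟩ : DomainSAW Ω δ b a).curve = CurveClass.reverse γ.curve := by
  rw [DomainSAW.curve, DomainSAW.curve, CurveClass.reverse_mk, CurveClass.mk_eq_mk]
  simp only [SimpleGraph.Walk.toCurve, SimpleGraph.Walk.support_reverse, List.map_reverse]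
  exact Literature.Probability.Percolation.reparamDist_polyline_reverse _

/-- The critical SAW measure of a set: the sum of the weights `x_c^{|γ|}` over the set. [folklore] -/
theorem weight_apply_tsum (T : Set (DomainSAW Ω δ a b)) :
    weight Ω δ a b T = ∑' γ : DomainSAW Ω δ a b,
      T.indicator (fun γ => ENNReal.ofReal (criticalFugacity ^ γ.length)) γ := by
  rw [weight, Measure.sum_apply _ MeasurableSpace.measurableSet_top]
  refine tsum_congr fun γ => ?_
  rw [Measure.smul_apply, smul_eq_mul, Measure.dirac_apply' _ MeasurableSpace.measurableSet_top]
  by_cases hγ : γ ∈ T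
  · simp [hγ]
  · simp [hγ]

/-- **Exact reversal invariance of the critical weight** `γ ↦ x_c^{|γ|}` (LSW 2004 §3.1): pushing
the critical SAW measure of `a → b` forward along time reversal gives that of `b → a`. [folklore] -/
theorem map_reverse_weight :
    (weight Ω δ a b).map (fun γ => (⟨γ.walk.reverse, γ.isPath.reverse⟩ : DomainSAW Ω δ b a)) =
      weight Ω δ b a := by
  classical
  ext T -
  rw [Measure.map_apply (DomainSAW.measurable_of_top _) MeasurableSpace.measurableSet_top,
    weight_apply_tsum, weight_apply_tsum]
  -- reindex the sum along the time-reversal bijection (built inline, no global definition)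
  rw [← (Equiv.mk (fun γ : DomainSAW Ω δ a b => (⟨γ.walk.reverse, γ.isPath.reverse⟩ : DomainSAW Ω δ b a))
    (fun γ => ⟨γ.walk.reverse, γ.isPath.reverse⟩) reverse_reverse_saw reverse_reverse_saw).tsum_eq
    (fun γ' => T.indicator (fun γ' => ENNReal.ofReal (criticalFugacity ^ γ'.length)) γ')]
  refine tsum_congr fun γ => ?_
  simp only [Equiv.coe_fn_mk, Set.indicator_apply, Set.mem_preimage, length_reverse_saw]

/-- The total weights `Z_δ(a → b)` and `Z_δ(b → a)` agree. [folklore] -/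
theorem weight_univ_swap : weight Ω δ b a univ = weight Ω δ a b univ := by
  rw [← map_reverse_weight,
    Measure.map_apply (DomainSAW.measurable_of_top _) MeasurableSpace.measurableSet_top, preimage_univ]

/-- **Exact lattice reversibility of the critical SAW law** (every mesh, every pair of endpoints,
junk cases included): the law of `b → a` is the push-forward of the law of `a → b` along time
reversal. [folklore] -/
theorem map_reverse_law :
    (law Ω δ a b).map (fun γ => (⟨γ.walk.reverse, γ.isPath.reverse⟩ : DomainSAW Ω δ b a)) =
      law Ω δ b a := by
  rw [law, law, Measure.map_smul, map_reverse_weight, weight_univ_swap]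

/-- Integration against the `b → a` law is integration of the reversed observable against the
`a → b` law. [folklore] -/
theorem integral_law_swap {F : Type*} [NormedAddCommGroup F] [NormedSpace ℝ F]
    (f : DomainSAW Ω δ b a → F) :
    ∫ γ, f γ ∂(law Ω δ b a) =
      ∫ γ, f (⟨γ.walk.reverse, γ.isPath.reverse⟩ : DomainSAW Ω δ b a) ∂(law Ω δ a b) := by
  rw [← map_reverse_law]
  -- time reversal as a measurable equivalence (built inline, no global definition)
  exact integral_map_equiv
    ({ toFun := fun γ : DomainSAW Ω δ a b => (⟨γ.walk.reverse, γ.isPath.reverse⟩ : DomainSAW Ω δ b a)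
       invFun := fun γ => ⟨γ.walk.reverse, γ.isPath.reverse⟩
       left_inv := reverse_reverse_saw
       right_inv := reverse_reverse_saw
       measurable_toFun := DomainSAW.measurable_of_top _
       measurable_invFun := DomainSAW.measurable_of_top _ } : DomainSAW Ω δ a b ≃ᵐ DomainSAW Ω δ b a) f

/-- For every observable `f` of the curve class:
`∫ f(γ.curve) dP^{(b,a)}_δ = ∫ f(reverse γ.curve) dP^{(a,b)}_δ`. [folklore] -/
theorem integral_curve_law_swap {F : Type*} [NormedAddCommGroup F] [NormedSpace ℝ F]
    (f : CurveClass ℂ → F) :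
    ∫ γ, f γ.curve ∂(law Ω δ b a) = ∫ γ, f (CurveClass.reverse γ.curve) ∂(law Ω δ a b) := by
  rw [integral_law_swap]
  simp_rw [curve_reverse_saw]

/-- The pushed-forward laws on curve space: `P^{(b,a)}_δ ∘ curve⁻¹ = reverse_* (P^{(a,b)}_δ ∘ curve⁻¹)`.
[folklore] -/
theorem map_curve_law_swap :
    (law Ω δ b a).map (fun γ => γ.curve) = ((law Ω δ a b).map (fun γ => γ.curve)).map CurveClass.reverse := by
  rw [Measure.map_map CurveClass.measurable_reverse (DomainSAW.measurable_of_top _),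
    ← map_reverse_law, Measure.map_map (DomainSAW.measurable_of_top _) (DomainSAW.measurable_of_top _)]
  congr 1
  funext γ
  simp [curve_reverse_saw]

end Lattice

/-! ## §2 Endpoint approximations read backwards approximate the swapped domain -/

section Swap

variable {D : DobrushinDomain} {a b : ℝ → Site 2}

/-- An endpoint approximation of `(D; a, b)`, read backwards, is an endpoint approximation of
`D.swap = (D; b, a)` (same carrier, marked points exchanged). [folklore] -/
theorem isEndpointApprox_swap (h : IsEndpointApprox D a b) : IsEndpointApprox D.swap b a where
  reachable := h.reachable.mono fun δ hδ => hδ.symm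
  tendsto_fst := by
    rw [MarkedDomain.pt_swap_zero]
    exact h.tendsto_snd
  tendsto_snd := by
    rw [MarkedDomain.pt_swap_one]
    exact h.tendsto_fst

/-- … and conversely. [folklore] -/
theorem isEndpointApprox_of_swap (h : IsEndpointApprox D.swap b a) : IsEndpointApprox D a b where
  reachable := h.reachable.mono fun δ hδ => hδ.symm
  tendsto_fst := by
    rw [← MarkedDomain.pt_swap_one D]
    exact h.tendsto_snd
  tendsto_snd := by
    rw [← MarkedDomain.pt_swap_zero D]
    exact h.tendsto_fst

/-- `swap` exchanges endpoint approximations (iff form). [folklore] -/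
theorem isEndpointApprox_swap_iff : IsEndpointApprox D.swap b a ↔ IsEndpointApprox D a b :=
  ⟨isEndpointApprox_of_swap, isEndpointApprox_swap⟩

end Swap

end Summit.CriticalPhenomena.SAWScalingLimit.Theorems.SubseqIdentification.Negative
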